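import Literature.AlgebraicGeometry.AbelianVarieties.PicZeroSheafCohomologyVanishing
import Literature.AlgebraicGeometry.AbelianSchemes.RigidifiedLineBundleTensor
import HarnessLib

/-!
# The Poincaré sheaf off the unit point: `𝒫|_{A × {b}} ≇ 𝒪` for `b ≠ ε_Â(s)`, hence `Hᵖ(A_s, 𝒫|_{A × {b}}) = 0` for all `p`
# (Mumford AV §13; GW II Lemma 27.226 (1) via Lemma 27.197)

Layer `Literature/AlgebraicGeometry/AbelianSchemes`, namespace `Literature.AlgebraicGeometry.AbelianSchemes.AbelianSchemeOver.DualPair`.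
THEOREMS ONLY (no definition, no named fact, no instance, no notation, no `sorry`).  Cell `hodgecm-mathlib` (D-0151), P6 «MOD programme»,
the «H1-DIM in char `p`» pay-down, road D2 («`Rⁱp₂,∗𝒫` is supported at the unit section», [MumfordAV1970] §13) — FIRST BRICK (prover seat
B-p02 (g22), capital).

For a dual pair `D = (Â, 𝒫)` of an abelian scheme `A → S` ([MilneAV2008] I §8: `𝒫` rigidified along `ε_A × 1`, fibrewise in `Pic⁰`, universal)
satisfying the unit hypothesis `hD : 𝒫|_{A × {ε_Â}} ≅ 𝒪` (★ `AbelianSchemeDualTransport`; automatic for the dual pair of a polarization, ★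
`AbelianSchemeDualTransportUnit`), and a point `b : Spec K → Â` with values in a field `K` (§1) ∕ an algebraically closed field `Ω` (§2) over `s = b ≫ π̂`:

* §1 **`nonempty_pullback_fibreSlice_iso_unit_iff`** — `𝒫|_{A_s × {b}} ≅ 𝒪_{A_s}` **iff** `b = ε_Â(s)` (`⇒`: the UNIQUENESS half of the
  universal property ★ `DualPair.eq_of_nonempty_iso` applied over `T = Spec K` to the trivial rigidified family `𝒪_{A_s}`, which both `b` and
  `ε_Â(s)` classify — the latter by ★ `nonempty_pullbackP_comp_unitSection_iso hD`; `⇐`: that lemma); corollaries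
  `eq_comp_unitSection_of_nonempty_pullback_fibreSlice_iso_unit`, `isEmpty_pullback_fibreSlice_iso_unit_of_ne`.  This is [GortzWedhorn2023]
  proof of Lemma 27.226 (1): «`𝒫_y ≇ 𝒪_{X_y}` if and only if `y ∉ e′(S)`».
* §2 **`subsingleton_sheafH_pullback_fibreSlice_of_ne`** (base `S : Scheme.{0}`) — for `b ≠ ε_Â(s)`: `Hᵖ(A_s, 𝒫|_{A_s × {b}}) = 0` for ALL
  `p : ℕ` in Mathlib's `Sheaf.H` (★ D1 `subsingleton_sheafH_of_isHomogeneous` = [GortzWedhorn2023] Lemma 27.197 ∕ [MumfordAV1970] §8 (vii),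
  fed with §1, the `DualPair` field `fibrewisePicZero` and ★ `hasRank_pullback`); contrapositive
  `eq_comp_unitSection_of_nontrivial_sheafH_pullback_fibreSlice`.  This is the pointwise input of [MumfordAV1970] §13 («`Hⁱ(X, P_α) = 0` for
  `α ≠ 0`, hence `Rⁱp₂,∗(P)` is supported at `0`») and of [GortzWedhorn2023] (27.43.1).

HC_CM is proved only modulo the printed citations (2 remaining named inputs hLiu418, h413) until rung 0 closes; this file asserts nothing about HC
and is count-neutral ★ capital.

## References
* [MumfordAV1970] D. Mumford, *Abelian Varieties* (1970), §13 «The cohomology of the Poincaré sheaf» (proof of the Theorem, pp. 127–129), §8 (vii)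
  (p. 76).
* [GortzWedhorn2023] U. Görtz, T. Wedhorn, *Algebraic Geometry II* (2023), (27.43) Lemma 27.226 (1) and its proof (pp. 910–911), Lemma 27.197
  (p. 893).
* [MilneAV2008] J. S. Milne, *Abelian Varieties* (v2.0, 2008), I §8 pp. 36–37 (the dual pair and its universal property).
-/

noncomputable section

-- `TopCat.Presheaf`/`Scheme.Modules` are not reducible (as in ★ `AbelianSchemeDualTransport`).
set_option backward.isDefEq.respectTransparency false

open CategoryTheory CategoryTheory.Limits AlgebraicGeometry

universe u

namespace Literature.AlgebraicGeometry.AbelianSchemes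

namespace AbelianSchemeOver

open Literature.AlgebraicGeometry.Motives Literature.AlgebraicGeometry.AbelianVarieties Literature.AlgebraicGeometry.Modules

namespace DualPair

/-! ## §1 `𝒫|_{A × {b}} ≅ 𝒪` iff `b` is the unit point -/

section AnyUniverse

variable {S : Scheme.{u}} {A : AbelianSchemeOver S} (D : A.DualPair) {K : Type u} [Field K]

/-- **`𝒫|_{A_s × {b}} ≅ 𝒪` forces `b = ε_Â(s)`** for a field-valued point `b : Spec K → Â` over `s = b ≫ π̂` (the uniqueness half of the
universal property of the dual pair, [MilneAV2008] I §8, applied over `T = Spec K` to the trivial rigidified family `𝒪_{A_s}`: both `b` and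
`ε_Â(s)` classify it — the latter under the unit hypothesis `hD`, ★ `nonempty_pullbackP_comp_unitSection_iso`).  [GortzWedhorn2023] proof of
Lemma 27.226 (1): «`𝒫_y ≇ 𝒪_{X_y}` if `y ∉ e′(S)`». [cite: GortzWedhorn2023, Lemma 27.226 (1), proof (p. 911)] [cite: MilneAV2008, I §8 pp. 36–37] -/
theorem eq_comp_unitSection_of_nonempty_pullback_fibreSlice_iso_unit
    (hD : Nonempty ((Scheme.Modules.pullback (unitHatSlice D)).obj D.P ≅ SheafOfModules.unit _))
    (b : Spec (.of K) ⟶ D.hat.X.left)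
    (h : Nonempty ((Scheme.Modules.pullback (A.fibreSlice D.hat b)).obj D.P ≅ SheafOfModules.unit _)) :
    b = (b ≫ D.hat.X.hom) ≫ D.hat.unitSection := by
  have hb' : ((b ≫ D.hat.X.hom) ≫ D.hat.unitSection) ≫ D.hat.X.hom = b ≫ D.hat.X.hom := by
    rw [Category.assoc, D.hat.unitSection_comp_hom, Category.comp_id]
  -- the trivial rigidified family `𝒪` on `A_s`, fibrewise in `Pic⁰`
  have hℒ : (⟨SheafOfModules.unit _, hasRank_unit_one, ⟨RigidifiedLineBundle.pullbackUnitIso _⟩⟩ :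
      A.RigidifiedLineBundle (b ≫ D.hat.X.hom)).FibrewisePicZero :=
    fun Ω _ _ t => (isHomogeneous_iff_of_iso _ (RigidifiedLineBundle.pullbackUnitIso _)).2 (isHomogeneous_unit _)
  exact D.eq_of_nonempty_iso (b ≫ D.hat.X.hom) _ hℒ b ((b ≫ D.hat.X.hom) ≫ D.hat.unitSection) rfl hb' h
    (D.nonempty_pullbackP_comp_unitSection_iso (b ≫ D.hat.X.hom) hD hb')

/-- **`𝒫|_{A_s × {b}} ≅ 𝒪_{A_s}` iff `b = ε_Â(s)`** for a field-valued point `b : Spec K → Â` over `s = b ≫ π̂`, under the unit hypothesis `hD`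
([GortzWedhorn2023] proof of Lemma 27.226 (1): «`𝒫_y ≇ 𝒪_{X_y}` if and only if `y ∉ e′(S)`»; `⇐` is ★ `nonempty_pullbackP_comp_unitSection_iso`).
[cite: GortzWedhorn2023, Lemma 27.226 (1), proof (p. 911)] [cite: MilneAV2008, I §8 pp. 36–37] -/
theorem nonempty_pullback_fibreSlice_iso_unit_iff
    (hD : Nonempty ((Scheme.Modules.pullback (unitHatSlice D)).obj D.P ≅ SheafOfModules.unit _))
    (b : Spec (.of K) ⟶ D.hat.X.left) :
    Nonempty ((Scheme.Modules.pullback (A.fibreSlice D.hat b)).obj D.P ≅ SheafOfModules.unit _) ↔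
      b = (b ≫ D.hat.X.hom) ≫ D.hat.unitSection := by
  refine ⟨D.eq_comp_unitSection_of_nonempty_pullback_fibreSlice_iso_unit hD b, fun hb => ?_⟩
  have hb' : ((b ≫ D.hat.X.hom) ≫ D.hat.unitSection) ≫ D.hat.X.hom = b ≫ D.hat.X.hom := by
    rw [Category.assoc, D.hat.unitSection_comp_hom, Category.comp_id]
  have key : D.pullbackP (b ≫ D.hat.X.hom) b rfl = D.pullbackP (b ≫ D.hat.X.hom) ((b ≫ D.hat.X.hom) ≫ D.hat.unitSection) hb' :=
    D.pullbackP_congr _ hb _ _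
  change Nonempty (D.pullbackP (b ≫ D.hat.X.hom) b rfl ≅ _)
  rw [key]
  exact D.nonempty_pullbackP_comp_unitSection_iso (b ≫ D.hat.X.hom) hD hb'

/-- **`𝒫|_{A_s × {b}} ≇ 𝒪_{A_s}` for `b ≠ ε_Â(s)`** (field-valued point `b : Spec K → Â` over `s = b ≫ π̂`, unit hypothesis `hD`).
[cite: GortzWedhorn2023, Lemma 27.226 (1), proof (p. 911)] [cite: MumfordAV1970, §13 (pp. 127–129)] -/
theorem isEmpty_pullback_fibreSlice_iso_unit_of_ne
    (hD : Nonempty ((Scheme.Modules.pullback (unitHatSlice D)).obj D.P ≅ SheafOfModules.unit _))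
    {b : Spec (.of K) ⟶ D.hat.X.left} (hb : b ≠ (b ≫ D.hat.X.hom) ≫ D.hat.unitSection) :
    IsEmpty ((Scheme.Modules.pullback (A.fibreSlice D.hat b)).obj D.P ≅ SheafOfModules.unit _) :=
  ⟨fun i => hb (D.eq_comp_unitSection_of_nonempty_pullback_fibreSlice_iso_unit hD b ⟨i⟩)⟩

/-- `𝒫|_{A_s × {b}}` is a line bundle on `A_s` (★ `hasRank_pullback` of the `DualPair` field `hasRank_one`). [cite: MilneAV2008, I §8 pp. 36–37] -/
theorem hasRank_pullback_fibreSlice_one (b : Spec (.of K) ⟶ D.hat.X.left) :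
    HasRank ((Scheme.Modules.pullback (A.fibreSlice D.hat b)).obj D.P) 1 :=
  hasRank_pullback _ D.hasRank_one

end AnyUniverse

/-! ## §2 `Hᵖ(A_s, 𝒫|_{A × {b}}) = 0` for `b ≠ ε_Â(s)` and all `p` -/

section UniverseZero

variable {S : Scheme.{0}} {A : AbelianSchemeOver S} (D : A.DualPair) {Ω : Type} [Field Ω] [IsAlgClosed Ω]

/-- **THE POINCARÉ SHEAF HAS NO COHOMOLOGY OFF THE UNIT POINT** ([MumfordAV1970] §13: «`Hⁱ(X, P_α) = 0` for all `i` and `α ≠ 0`»;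
[GortzWedhorn2023] proof of Lemma 27.226 (1): «hence `Hⁱ(X_y, 𝒫_y) = 0` for all `i` if `y ∈ Xᵗ ∖ e′(S)` by Lemma 27.197»): for a dual
pair with the unit hypothesis `hD` and a geometric point `b ≠ ε_Â(s)` of `Â` over `s = b ≫ π̂`, `Hᵖ(A_s, 𝒫|_{A_s × {b}}) = 0` for every
`p : ℕ`, in Mathlib's `Sheaf.H` of the underlying abelian sheaf — ★ D1 `subsingleton_sheafH_of_isHomogeneous` (non-trivial `Pic⁰` bundles are
acyclic) for the line bundle `𝒫|_{A_s × {b}}` (`fibrewisePicZero`; non-trivial by §1). [cite: MumfordAV1970, §13 (pp. 127–129)]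
[cite: GortzWedhorn2023, Lemma 27.226 (1), proof (p. 911)] [cite: GortzWedhorn2023, Lemma 27.197 (p. 893)] -/
theorem subsingleton_sheafH_pullback_fibreSlice_of_ne
    (hD : Nonempty ((Scheme.Modules.pullback (unitHatSlice D)).obj D.P ≅ SheafOfModules.unit _))
    {b : Spec (.of Ω) ⟶ D.hat.X.left} (hb : b ≠ (b ≫ D.hat.X.hom) ≫ D.hat.unitSection) (p : ℕ) :
    Subsingleton ((Modules.abSheaf ((Scheme.Modules.pullback (A.fibreSlice D.hat b)).obj D.P)).H p) :=
  subsingleton_sheafH_of_isHomogeneous (A.fibre (b ≫ D.hat.X.hom)).toAbelianVariety (D.hasRank_pullback_fibreSlice_one b)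
    (D.fibrewisePicZero Ω b) (D.isEmpty_pullback_fibreSlice_iso_unit_of_ne hD hb) p

/-- **Contrapositive**: if some `Hᵖ(A_s, 𝒫|_{A_s × {b}})` is non-trivial then `b` is the unit point `ε_Â(s)` — `Rⁱp₂,∗𝒫` «is supported at
`0`» pointwise ([MumfordAV1970] §13; [GortzWedhorn2023] (27.43.1)). [cite: MumfordAV1970, §13 (pp. 127–129)]
[cite: GortzWedhorn2023, Lemma 27.226 (1), proof (p. 911)] -/
theorem eq_comp_unitSection_of_nontrivial_sheafH_pullback_fibreSlice
    (hD : Nonempty ((Scheme.Modules.pullback (unitHatSlice D)).obj D.P ≅ SheafOfModules.unit _))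
    (b : Spec (.of Ω) ⟶ D.hat.X.left) {p : ℕ}
    (h : Nontrivial ((Modules.abSheaf ((Scheme.Modules.pullback (A.fibreSlice D.hat b)).obj D.P)).H p)) :
    b = (b ≫ D.hat.X.hom) ≫ D.hat.unitSection := by
  by_contra hb
  exact not_subsingleton _ (D.subsingleton_sheafH_pullback_fibreSlice_of_ne hD hb p)

end UniverseZero

end DualPair

end AbelianSchemeOver

end Literature.AlgebraicGeometry.AbelianSchemes

end
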